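import Summits.QuantumFields.BalabanUV.Beta.D1BFx.SliceTransferGhost
import Summits.QuantumFields.BalabanUV.Beta.D1BFx.SliceTransferGhostJets
import Summits.QuantumFields.BalabanUV.Beta.D1BFx.MixedVarPackedHess

/-!
# `BalabanUV.Beta.D1BFx.GhostSplitJets` — road «BF-x» for binder row D1, slot (K), X₃(ii) ROUTE T, Tier B brick **K-TB3a** (part 1 of 2)
# «GHOST SPLIT, JET FORM» (model): the bordered functional of a square is twice the scalar tower plus the coarse Gram,
# `h[kkt (M·M) Q] = 2·h[M] + h[Q(M·M)⁻¹Qᵀ]`, from 2-JETS ONLY, in the `secondVar` ∕ `mixedVar` ∕ `hessT` currencies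

HONEST DEPENDENCY (cell records, verbatim): «continuum YM on T⁴ ⇐ BetaPertH ∧ nine spine estimates (0/9 proved); BetaPertH ⇐ (D1) ∧ (D4) ∧
CAP+tail; G-an2-4 gates asym, D1 and NE2/3/4.»  HONEST FRAMING (cell contract, verbatim): «discharging `BetaPertH` makes Bałaban's UV stability
UNCONDITIONAL — a real constructive-QFT result; it is NOT the continuum limit and NOT the Clay problem.»  THIS MODULE DISCHARGES NOTHING of (K),
of D1 or of the wall: [folklore] finite-dimensional matrix calculus (Mathlib) over the road owner's model chain — part 4 `SliceTransferGhost`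
(`secondVar_kkt_mul_self`), its supplier `SliceTransferGhostJets` (`hasDerivAt_coarseGram_eventually∕₁`), the quadratic Taylor curves
`SliceTransferJets.pc∕lc`, `SliceTransferJetsMixed` (`mixedVar`, `secondVar_diag`, `kkt_add∕kkt_smul`) and TA4 `MixedVarPackedHess` (`hessT`).
No `def`, no `def … : Prop`, nothing cited, 0 sorry; 0∕4 row-D1 binders; NOT D1, NOT BetaPertH, NOT continuum, NOT Clay.

ABSOLUTE RULE (cell charter, verbatim): «No internally-minted statement may enter as a cited fact. Every hypothesis is either kernel-proved in this
package or a verbatim quotation of a PUBLISHED theorem with page reference. The manuscript(s) under audit are NOT citable for their own disputed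
steps — they are the thing under adjudication; programme-internal (2001/route/tribunal) claims are never citable.»

WHERE THIS SITS (`HOME/b2b-balaban-beta-d1-p2/K-ASSEMBLY-SPEC-v2.md` v2.0 §0 DECISION 2, §2 brick K-TB3a).  The ghost side of the Gram-form jet
identity is reduced (part 2 of this brick, `GhostCompressionJets`: compression `h[NᵀXN] = h[kkt X Q]`, shift `h[kkt Δ²Q] = h[kkt (Δ + QᵀaQ)² Q]`)
to the bordered functional of a SQUARE `kkt (M·M) Q`, which the owner's part 4 splits ALONG `C²` CURVES as `2·h[M] + h[Q(MM)⁻¹Qᵀ]` — scalar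
tower twice plus the coarse Gram (loop weights `−2 : −1` of the END's `hω`).  The torus∕kernel consumer (TB3c, TB5) has 2-JETS (tables), not
curves.  This file removes the curves: every statement is an identity between functionals of MATRICES; the derived jets — of the square `X = M·M`
and of the coarse Gram `S = Q X⁻¹ Qᵀ` — enter as LETTERS WITH THEIR DEFINING PRODUCT-RULE EQUATIONS (hypotheses `hX₀ … hSₛₜ`, discharged by
`rfl`∕`simp` on the consumer's data), so no `def` is needed and the statement is the one a table-level consumer instantiates.  Method: realise
the 2-jets by the quadratic Taylor curves `pc`, feed the curve theorem, read the jets at `0` (§1); polarise with ZERO pure second jets of the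
primary letters `M`, `Q` — the derived letters then have the pure second jets `2·MₛMₛ` etc., which appear in the proof only (§2).

CONTENT (all [folklore]):
* §1 `secondVar_kkt_sq_jets` — ONE-PARAMETER JET FORM of `secondVar_kkt_mul_self`: `secondVar (kkt X₀ Q₀) (kkt X₁ Q₁) (kkt X₂ Q₂) =
  2·secondVar M₀ M₁ M₂ + secondVar S₀ S₁ S₂` (`det M₀ ≠ 0`, `det S₀ ≠ 0`; the constraint jet `Q₀ Q₁ Q₂` is FREE — no Ward relation).
* §2 `two_mul_mixedVar_eq_polar` (polarisation solved for the mixed functional), the bordered-jet bookkeeping `kkt_polar`, `kkt_zero_polar`,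
  `kkt_add_zero`; **`mixedVar_kkt_sq_jets`** (2-parameter∕MIXED form); **`hessT_kkt_sq_jets`**:
  `hessT (kkt X₀ Q₀)⁻¹ (kkt Xₛ Qₛ) (kkt Xₜ Qₜ) (kkt Xₛₜ Qₛₜ) = 2·hessT M₀⁻¹ Mₛ Mₜ Mₛₜ + hessT S₀⁻¹ Sₛ Sₜ Sₛₜ`; and its LEG-SOCKET form
  `hessT_kkt_sq_jets_of_mul_eq_one` (legs `L`, `Gm`, `Gs` with `kkt X₀ Q₀·L = 1`, `M₀·Gm = 1`, `S₀·Gs = 1`).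
NOT HERE: compression and shift (part 2), periodisation, `ℤ⁴` kernels, the torus objects of TB3b, the ghost legs of TB3c, the comb Gram TB3d, TB4∕TB5.
Provenance: NE9 formalisation swarm leaf seat `b2b-balaban-t4-ne9-formalise-leaf-02` gen 25 (cross-row, road «BF-x» brick K-TB3a on the owner's
invitation `K-ASSEMBLY-SPEC-v2.md` §5 «CLAIMABLE NOW»), 2026-08-20.
-/

noncomputable section

namespace Summit.QuantumFields.BalabanUV.Beta.D1BFx.GhostSplitJets

open Matrix Filter
open scoped Topology
open Literature.MathematicalPhysics.QuantumFieldTheory.Balaban1983to89.Beta.Composition (kkt)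
open Summit.QuantumFields.BalabanUV.Beta.D1BFx.LogDetSecondVariation (secondVar)
open Summit.QuantumFields.BalabanUV.Beta.D1BFx.SliceTransferModel (hasDerivAt_matMul hasDerivAt_matAdd)
open Summit.QuantumFields.BalabanUV.Beta.D1BFx.SliceTransferJets (pc lc of_pc of_lc of_pc_zero of_lc_zero hasDerivAt_pc hasDerivAt_lc)
open Summit.QuantumFields.BalabanUV.Beta.D1BFx.SliceTransferJetsMixed (mixedVar secondVar_diag kkt_add kkt_smul)
open Summit.QuantumFields.BalabanUV.Beta.D1BFx.SliceTransferGhost (secondVar_kkt_mul_self)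
open Summit.QuantumFields.BalabanUV.Beta.D1BFx.SliceTransferGhostJets (hasDerivAt_coarseGram_eventually hasDerivAt_coarseGram₁)
open Summit.QuantumFields.BalabanUV.Beta.D1BFx.MixedVarPackedHess (hessT mixedVar_eq_two_mul_hessT mixedVar_eq_two_mul_hessT_of_mul_eq_one)

/-! ## §1 The ghost split from 2-jets: one parameter -/

section Split

variable {σ κ : Type*} [Fintype σ] [Fintype κ] [DecidableEq σ] [DecidableEq κ]

/-- [folklore] **THE BORDERED FUNCTIONAL OF A SQUARE, JET FORM** (`SliceTransferGhost.secondVar_kkt_mul_self` without curves).  Letters: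
`M₀ M₁ M₂` (2-jet of the scalar tower), `Q₀ Q₁ Q₂` (2-jet of the constraint, FREE), and the DERIVED letters with their product-rule
equations — the square `X₀ = M₀M₀`, `X₁ = M₁M₀ + M₀M₁`, `X₂ = M₂M₀ + 2·M₁M₁ + M₀M₂` and the coarse Gram `S₀ = Q₀X₀⁻¹Q₀ᵀ`,
`S₁ = Q₁X₀⁻¹Q₀ᵀ + Q₀X₀⁻¹Q₁ᵀ − Q₀X₀⁻¹X₁X₀⁻¹Q₀ᵀ`, `S₂ = Q₂X₀⁻¹Q₀ᵀ + 2·Q₁X₀⁻¹Q₁ᵀ + Q₀X₀⁻¹Q₂ᵀ − 2·Q₁X₀⁻¹X₁X₀⁻¹Q₀ᵀ − 2·Q₀X₀⁻¹X₁X₀⁻¹Q₁ᵀ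
+ 2·Q₀X₀⁻¹X₁X₀⁻¹X₁X₀⁻¹Q₀ᵀ − Q₀X₀⁻¹X₂X₀⁻¹Q₀ᵀ`.  If `det M₀ ≠ 0` and `det S₀ ≠ 0`:
`secondVar (kkt X₀ Q₀) (kkt X₁ Q₁) (kkt X₂ Q₂) = 2·secondVar M₀ M₁ M₂ + secondVar S₀ S₁ S₂`. -/
theorem secondVar_kkt_sq_jets (M₀ M₁ M₂ X₀ X₁ X₂ : Matrix (σ ⊕ κ) (σ ⊕ κ) ℝ) (Q₀ Q₁ Q₂ : Matrix κ (σ ⊕ κ) ℝ) (S₀ S₁ S₂ : Matrix κ κ ℝ)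
    (hX₀ : X₀ = M₀ * M₀) (hX₁ : X₁ = M₁ * M₀ + M₀ * M₁) (hX₂ : X₂ = M₂ * M₀ + (2 : ℝ) • (M₁ * M₁) + M₀ * M₂)
    (hS₀ : S₀ = Q₀ * X₀⁻¹ * Q₀ᵀ)
    (hS₁ : S₁ = Q₁ * X₀⁻¹ * Q₀ᵀ + Q₀ * X₀⁻¹ * Q₁ᵀ - Q₀ * X₀⁻¹ * X₁ * X₀⁻¹ * Q₀ᵀ)
    (hS₂ : S₂ = Q₂ * X₀⁻¹ * Q₀ᵀ + (2 : ℝ) • (Q₁ * X₀⁻¹ * Q₁ᵀ) + Q₀ * X₀⁻¹ * Q₂ᵀ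
        - (2 : ℝ) • (Q₁ * X₀⁻¹ * X₁ * X₀⁻¹ * Q₀ᵀ) - (2 : ℝ) • (Q₀ * X₀⁻¹ * X₁ * X₀⁻¹ * Q₁ᵀ)
        + (2 : ℝ) • (Q₀ * X₀⁻¹ * X₁ * X₀⁻¹ * X₁ * X₀⁻¹ * Q₀ᵀ) - Q₀ * X₀⁻¹ * X₂ * X₀⁻¹ * Q₀ᵀ)
    (hM : M₀.det ≠ 0) (hS : S₀.det ≠ 0) :
    secondVar (kkt X₀ Q₀) (kkt X₁ Q₁) (kkt X₂ Q₂) = 2 * secondVar M₀ M₁ M₂ + secondVar S₀ S₁ S₂ := by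
  have h0 : (0 : ℝ) ^ 2 / 2 = 0 := by norm_num
  -- the quadratic Taylor curves of the primary letters and the product curve `X = M·M`
  have hMc : ∀ u, HasDerivAt (pc M₀ M₁ M₂) (lc M₁ M₂ u) u := hasDerivAt_pc M₀ M₁ M₂
  have hQc : ∀ u, HasDerivAt (pc Q₀ Q₁ Q₂) (lc Q₁ Q₂ u) u := hasDerivAt_pc Q₀ Q₁ Q₂
  have hXc : ∀ u, HasDerivAt (fun u => Matrix.of.symm (Matrix.of (pc M₀ M₁ M₂ u) * Matrix.of (pc M₀ M₁ M₂ u)))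
      ((fun u => Matrix.of.symm (Matrix.of (lc M₁ M₂ u) * Matrix.of (pc M₀ M₁ M₂ u)
        + Matrix.of (pc M₀ M₁ M₂ u) * Matrix.of (lc M₁ M₂ u))) u) u :=
    fun u => hasDerivAt_matMul (hMc u) (hMc u)
  have hX₁c : HasDerivAt (fun u => Matrix.of.symm (Matrix.of (lc M₁ M₂ u) * Matrix.of (pc M₀ M₁ M₂ u)
        + Matrix.of (pc M₀ M₁ M₂ u) * Matrix.of (lc M₁ M₂ u)))
      (Matrix.of.symm (M₂ * M₀ + M₁ * M₁ + (M₁ * M₁ + M₀ * M₂))) 0 := by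
    have h := hasDerivAt_matAdd (hasDerivAt_matMul (hasDerivAt_lc M₁ M₂ 0) (hMc 0))
      (hasDerivAt_matMul (hMc 0) (hasDerivAt_lc M₁ M₂ 0))
    refine h.congr_deriv ?_
    simp only [of_pc, of_lc, h0, zero_smul, add_zero]
  -- nondegeneracy at `0`
  have hdM : (Matrix.of (pc M₀ M₁ M₂ 0)).det ≠ 0 := by rw [of_pc_zero]; exact hM
  have hdX : (Matrix.of ((fun u => Matrix.of.symm (Matrix.of (pc M₀ M₁ M₂ u) * Matrix.of (pc M₀ M₁ M₂ u))) 0)).det ≠ 0 := by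
    simp only [of_pc_zero, Equiv.apply_symm_apply, Matrix.det_mul]
    exact mul_ne_zero hM hM
  -- the coarse Gram curve `S = Q X⁻¹ Qᵀ` and its jets by the product rule (the supplier module)
  have hSc := hasDerivAt_coarseGram_eventually (t := 0) (Filter.Eventually.of_forall hQc) (Filter.Eventually.of_forall hXc) hdX
  have hS₁c := hasDerivAt_coarseGram₁ (Q := pc Q₀ Q₁ Q₂) (Q₁ := lc Q₁ Q₂) (Q₂ := Q₂) (t := 0)
    (X := fun u => Matrix.of.symm (Matrix.of (pc M₀ M₁ M₂ u) * Matrix.of (pc M₀ M₁ M₂ u)))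
    (X₁ := fun u => Matrix.of.symm (Matrix.of (lc M₁ M₂ u) * Matrix.of (pc M₀ M₁ M₂ u)
        + Matrix.of (pc M₀ M₁ M₂ u) * Matrix.of (lc M₁ M₂ u)))
    (hQc 0) (hasDerivAt_lc Q₁ Q₂ 0) (hXc 0) hX₁c hdX
  -- the curve theorem (owner's part 4), hypotheses `hXM`, `hSQ` by `rfl`
  have h := secondVar_kkt_mul_self (M := pc M₀ M₁ M₂) (M₁ := lc M₁ M₂) (M₂ := M₂) (Q := pc Q₀ Q₁ Q₂) (Q₁ := lc Q₁ Q₂) (Q₂ := Q₂)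
    (Filter.Eventually.of_forall hXc) hX₁c (Filter.Eventually.of_forall hQc) (hasDerivAt_lc Q₁ Q₂ 0)
    (Filter.Eventually.of_forall hMc) (hasDerivAt_lc M₁ M₂ 0) hSc hS₁c
    (Filter.Eventually.of_forall fun u => rfl) (Filter.Eventually.of_forall fun u => rfl) hdM ?_
  · simp only [of_pc, of_lc, h0, zero_smul, add_zero, Equiv.apply_symm_apply] at h
    subst hX₀ hX₁ hX₂ hS₀ hS₁ hS₂
    convert h using 3
    · rw [two_smul]; abel
    · simp only [Matrix.add_mul, Matrix.mul_add, Matrix.mul_neg, Matrix.neg_mul, Matrix.mul_assoc, sub_eq_add_neg]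
      abel
    · simp only [two_smul, Matrix.add_mul, Matrix.mul_add, Matrix.mul_neg, Matrix.neg_mul, neg_add, neg_neg,
        Matrix.mul_assoc, sub_eq_add_neg]
      abel
  · simp only [of_pc_zero, Equiv.apply_symm_apply]
    rw [← hX₀, ← hS₀]; exact hS

end Split

/-! ## §2 Polarisation: the mixed functional and the `hessT` currency -/

section Polar

variable {ι : Type*} [Fintype ι] [DecidableEq ι]

/-- [folklore] POLARISATION, solved for the mixed functional (`SliceTransferJetsMixed.secondVar_diag` rearranged):
`2·mixedVar A₀ Aₛ Aₜ Aₛₜ = secondVar A₀ (Aₛ + Aₜ) (Aₛₛ + 2·Aₛₜ + Aₜₜ) − secondVar A₀ Aₛ Aₛₛ − secondVar A₀ Aₜ Aₜₜ` (any pure second jets). -/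
theorem two_mul_mixedVar_eq_polar (A₀ Aₛ Aₜ Aₛₛ Aₜₜ Aₛₜ : Matrix ι ι ℝ) :
    2 * mixedVar A₀ Aₛ Aₜ Aₛₜ
      = secondVar A₀ (Aₛ + Aₜ) (Aₛₛ + (2 : ℝ) • Aₛₜ + Aₜₜ) - secondVar A₀ Aₛ Aₛₛ - secondVar A₀ Aₜ Aₜₜ := by
  rw [secondVar_diag]; ring

variable {ν μ : Type*}

/-- [folklore] Bordered-jet bookkeeping: `kkt (A + 2·B + C) (D + 2·E + F) = kkt A D + 2·kkt B E + kkt C F`. -/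
theorem kkt_polar (A B C : Matrix ν ν ℝ) (D E F : Matrix μ ν ℝ) :
    kkt (A + (2 : ℝ) • B + C) (D + (2 : ℝ) • E + F) = kkt A D + (2 : ℝ) • kkt B E + kkt C F := by
  rw [kkt_add, kkt_add, kkt_smul]

/-- [folklore] The same with a silent constraint jet: `kkt (A + 2·B + C) 0 = kkt A 0 + 2·kkt B 0 + kkt C 0`. -/
theorem kkt_zero_polar (A B C : Matrix ν ν ℝ) :
    kkt (A + (2 : ℝ) • B + C) (0 : Matrix μ ν ℝ) = kkt A 0 + (2 : ℝ) • kkt B 0 + kkt C 0 := by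
  rw [← kkt_polar, smul_zero, add_zero, add_zero]

/-- [folklore] `kkt (A + C) 0 = kkt A 0 + kkt C 0`. -/
theorem kkt_add_zero (A C : Matrix ν ν ℝ) : kkt (A + C) (0 : Matrix μ ν ℝ) = kkt A 0 + kkt C 0 := by
  rw [← kkt_add, add_zero]

end Polar

section SplitMixed

variable {σ κ : Type*} [Fintype σ] [Fintype κ] [DecidableEq σ] [DecidableEq κ]

/-- [folklore] **THE BORDERED FUNCTIONAL OF A SQUARE, MIXED (2-PARAMETER) JET FORM.**  Letters: first jets `Mₛ Mₜ` and mixed second jet `Mₛₜ`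
of the scalar tower, `Qₛ Qₜ Qₛₜ` of the (free) constraint; the derived letters `Xₛ = MₛM₀ + M₀Mₛ`, `Xₜ`, `Xₛₜ = MₛₜM₀ + MₛMₜ + MₜMₛ + M₀Mₛₜ`,
`Sₛ`, `Sₜ` (as `S₁` of §1 along `s`, `t`) and the MIXED coarse-Gram jet `Sₛₜ` (eleven words, displayed).  Then
`mixedVar (kkt X₀ Q₀) (kkt Xₛ Qₛ) (kkt Xₜ Qₜ) (kkt Xₛₜ Qₛₜ) = 2·mixedVar M₀ Mₛ Mₜ Mₛₜ + mixedVar S₀ Sₛ Sₜ Sₛₜ`. -/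
theorem mixedVar_kkt_sq_jets (M₀ Mₛ Mₜ Mₛₜ X₀ Xₛ Xₜ Xₛₜ : Matrix (σ ⊕ κ) (σ ⊕ κ) ℝ) (Q₀ Qₛ Qₜ Qₛₜ : Matrix κ (σ ⊕ κ) ℝ)
    (S₀ Sₛ Sₜ Sₛₜ : Matrix κ κ ℝ)
    (hX₀ : X₀ = M₀ * M₀) (hXₛ : Xₛ = Mₛ * M₀ + M₀ * Mₛ) (hXₜ : Xₜ = Mₜ * M₀ + M₀ * Mₜ)
    (hXₛₜ : Xₛₜ = Mₛₜ * M₀ + Mₛ * Mₜ + Mₜ * Mₛ + M₀ * Mₛₜ)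
    (hS₀ : S₀ = Q₀ * X₀⁻¹ * Q₀ᵀ)
    (hSₛ : Sₛ = Qₛ * X₀⁻¹ * Q₀ᵀ + Q₀ * X₀⁻¹ * Qₛᵀ - Q₀ * X₀⁻¹ * Xₛ * X₀⁻¹ * Q₀ᵀ)
    (hSₜ : Sₜ = Qₜ * X₀⁻¹ * Q₀ᵀ + Q₀ * X₀⁻¹ * Qₜᵀ - Q₀ * X₀⁻¹ * Xₜ * X₀⁻¹ * Q₀ᵀ)
    (hSₛₜ : Sₛₜ = Qₛₜ * X₀⁻¹ * Q₀ᵀ + Qₛ * X₀⁻¹ * Qₜᵀ + Qₜ * X₀⁻¹ * Qₛᵀ + Q₀ * X₀⁻¹ * Qₛₜᵀ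
        - Qₛ * X₀⁻¹ * Xₜ * X₀⁻¹ * Q₀ᵀ - Qₜ * X₀⁻¹ * Xₛ * X₀⁻¹ * Q₀ᵀ - Q₀ * X₀⁻¹ * Xₛ * X₀⁻¹ * Qₜᵀ - Q₀ * X₀⁻¹ * Xₜ * X₀⁻¹ * Qₛᵀ
        + Q₀ * X₀⁻¹ * Xₛ * X₀⁻¹ * Xₜ * X₀⁻¹ * Q₀ᵀ + Q₀ * X₀⁻¹ * Xₜ * X₀⁻¹ * Xₛ * X₀⁻¹ * Q₀ᵀ - Q₀ * X₀⁻¹ * Xₛₜ * X₀⁻¹ * Q₀ᵀ)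
    (hM : M₀.det ≠ 0) (hS : S₀.det ≠ 0) :
    mixedVar (kkt X₀ Q₀) (kkt Xₛ Qₛ) (kkt Xₜ Qₜ) (kkt Xₛₜ Qₛₜ) = 2 * mixedVar M₀ Mₛ Mₜ Mₛₜ + mixedVar S₀ Sₛ Sₜ Sₛₜ := by
  -- the pure second jets of the derived letters when the primary letters `M`, `Q` have ZERO pure second jets
  set Xₛₛ : Matrix (σ ⊕ κ) (σ ⊕ κ) ℝ := (2 : ℝ) • (Mₛ * Mₛ) with hXₛₛ
  set Xₜₜ : Matrix (σ ⊕ κ) (σ ⊕ κ) ℝ := (2 : ℝ) • (Mₜ * Mₜ) with hXₜₜ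
  set Sₛₛ : Matrix κ κ ℝ := (2 : ℝ) • (Qₛ * X₀⁻¹ * Qₛᵀ) - (2 : ℝ) • (Qₛ * X₀⁻¹ * Xₛ * X₀⁻¹ * Q₀ᵀ)
      - (2 : ℝ) • (Q₀ * X₀⁻¹ * Xₛ * X₀⁻¹ * Qₛᵀ) + (2 : ℝ) • (Q₀ * X₀⁻¹ * Xₛ * X₀⁻¹ * Xₛ * X₀⁻¹ * Q₀ᵀ)
      - Q₀ * X₀⁻¹ * Xₛₛ * X₀⁻¹ * Q₀ᵀ with hSₛₛ
  set Sₜₜ : Matrix κ κ ℝ := (2 : ℝ) • (Qₜ * X₀⁻¹ * Qₜᵀ) - (2 : ℝ) • (Qₜ * X₀⁻¹ * Xₜ * X₀⁻¹ * Q₀ᵀ)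
      - (2 : ℝ) • (Q₀ * X₀⁻¹ * Xₜ * X₀⁻¹ * Qₜᵀ) + (2 : ℝ) • (Q₀ * X₀⁻¹ * Xₜ * X₀⁻¹ * Xₜ * X₀⁻¹ * Q₀ᵀ)
      - Q₀ * X₀⁻¹ * Xₜₜ * X₀⁻¹ * Q₀ᵀ with hSₜₜ
  -- §1 along `s` and along `t` (pure second jets `0` of `M`, `Q`)
  have hs := secondVar_kkt_sq_jets M₀ Mₛ 0 X₀ Xₛ Xₛₛ Q₀ Qₛ 0 S₀ Sₛ Sₛₛ hX₀ hXₛ (by rw [hXₛₛ]; simp) hS₀ hSₛ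
    (by rw [hSₛₛ]; simp) hM hS
  have ht := secondVar_kkt_sq_jets M₀ Mₜ 0 X₀ Xₜ Xₜₜ Q₀ Qₜ 0 S₀ Sₜ Sₜₜ hX₀ hXₜ (by rw [hXₜₜ]; simp) hS₀ hSₜ
    (by rw [hSₜₜ]; simp) hM hS
  -- §1 along the diagonal `s + t` (pure second jets `0 + 2·Mₛₜ + 0`, `0 + 2·Qₛₜ + 0`)
  have hd := secondVar_kkt_sq_jets M₀ (Mₛ + Mₜ) (0 + (2 : ℝ) • Mₛₜ + 0) X₀ (Xₛ + Xₜ) (Xₛₛ + (2 : ℝ) • Xₛₜ + Xₜₜ)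
    Q₀ (Qₛ + Qₜ) (0 + (2 : ℝ) • Qₛₜ + 0) S₀ (Sₛ + Sₜ) (Sₛₛ + (2 : ℝ) • Sₛₜ + Sₜₜ) hX₀
    (by rw [hXₛ, hXₜ, Matrix.add_mul, Matrix.mul_add]; abel)
    (by rw [hXₛₛ, hXₜₜ, hXₛₜ]
        simp only [zero_add, add_zero, Matrix.add_mul, Matrix.mul_add, smul_add, two_smul]; abel)
    hS₀ (by rw [hSₛ, hSₜ]; simp only [Matrix.add_mul, Matrix.mul_add, Matrix.transpose_add]; abel)
    (by rw [hSₛₛ, hSₜₜ, hSₛₜ]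
        simp only [zero_add, add_zero, Matrix.add_mul, Matrix.mul_add, Matrix.transpose_add, smul_add, smul_sub, two_smul]
        abel)
    hM hS
  rw [kkt_add, kkt_polar] at hd
  have pK := two_mul_mixedVar_eq_polar (kkt X₀ Q₀) (kkt Xₛ Qₛ) (kkt Xₜ Qₜ) (kkt Xₛₛ 0) (kkt Xₜₜ 0) (kkt Xₛₜ Qₛₜ)
  have pM := two_mul_mixedVar_eq_polar M₀ Mₛ Mₜ 0 0 Mₛₜ
  have pS := two_mul_mixedVar_eq_polar S₀ Sₛ Sₜ Sₛₛ Sₜₜ Sₛₜ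
  linarith

/-- [folklore] **K-TB3a IN THE `hessT` CURRENCY**: under the letters of `mixedVar_kkt_sq_jets`,
`hessT (kkt X₀ Q₀)⁻¹ (kkt Xₛ Qₛ) (kkt Xₜ Qₜ) (kkt Xₛₜ Qₛₜ) = 2·hessT M₀⁻¹ Mₛ Mₜ Mₛₜ + hessT S₀⁻¹ Sₛ Sₜ Sₛₜ` — the bordered ghost is the scalar
tower (leg `M₀⁻¹`) with weight `2` plus the coarse Gram (leg `S₀⁻¹`) with weight `1`. -/
theorem hessT_kkt_sq_jets (M₀ Mₛ Mₜ Mₛₜ X₀ Xₛ Xₜ Xₛₜ : Matrix (σ ⊕ κ) (σ ⊕ κ) ℝ) (Q₀ Qₛ Qₜ Qₛₜ : Matrix κ (σ ⊕ κ) ℝ)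
    (S₀ Sₛ Sₜ Sₛₜ : Matrix κ κ ℝ)
    (hX₀ : X₀ = M₀ * M₀) (hXₛ : Xₛ = Mₛ * M₀ + M₀ * Mₛ) (hXₜ : Xₜ = Mₜ * M₀ + M₀ * Mₜ)
    (hXₛₜ : Xₛₜ = Mₛₜ * M₀ + Mₛ * Mₜ + Mₜ * Mₛ + M₀ * Mₛₜ)
    (hS₀ : S₀ = Q₀ * X₀⁻¹ * Q₀ᵀ)
    (hSₛ : Sₛ = Qₛ * X₀⁻¹ * Q₀ᵀ + Q₀ * X₀⁻¹ * Qₛᵀ - Q₀ * X₀⁻¹ * Xₛ * X₀⁻¹ * Q₀ᵀ)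
    (hSₜ : Sₜ = Qₜ * X₀⁻¹ * Q₀ᵀ + Q₀ * X₀⁻¹ * Qₜᵀ - Q₀ * X₀⁻¹ * Xₜ * X₀⁻¹ * Q₀ᵀ)
    (hSₛₜ : Sₛₜ = Qₛₜ * X₀⁻¹ * Q₀ᵀ + Qₛ * X₀⁻¹ * Qₜᵀ + Qₜ * X₀⁻¹ * Qₛᵀ + Q₀ * X₀⁻¹ * Qₛₜᵀ
        - Qₛ * X₀⁻¹ * Xₜ * X₀⁻¹ * Q₀ᵀ - Qₜ * X₀⁻¹ * Xₛ * X₀⁻¹ * Q₀ᵀ - Q₀ * X₀⁻¹ * Xₛ * X₀⁻¹ * Qₜᵀ - Q₀ * X₀⁻¹ * Xₜ * X₀⁻¹ * Qₛᵀ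
        + Q₀ * X₀⁻¹ * Xₛ * X₀⁻¹ * Xₜ * X₀⁻¹ * Q₀ᵀ + Q₀ * X₀⁻¹ * Xₜ * X₀⁻¹ * Xₛ * X₀⁻¹ * Q₀ᵀ - Q₀ * X₀⁻¹ * Xₛₜ * X₀⁻¹ * Q₀ᵀ)
    (hM : M₀.det ≠ 0) (hS : S₀.det ≠ 0) :
    hessT (kkt X₀ Q₀)⁻¹ (kkt Xₛ Qₛ) (kkt Xₜ Qₜ) (kkt Xₛₜ Qₛₜ) = 2 * hessT M₀⁻¹ Mₛ Mₜ Mₛₜ + hessT S₀⁻¹ Sₛ Sₜ Sₛₜ := by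
  have h := mixedVar_kkt_sq_jets M₀ Mₛ Mₜ Mₛₜ X₀ Xₛ Xₜ Xₛₜ Q₀ Qₛ Qₜ Qₛₜ S₀ Sₛ Sₜ Sₛₜ hX₀ hXₛ hXₜ hXₛₜ hS₀ hSₛ hSₜ hSₛₜ hM hS
  rw [mixedVar_eq_two_mul_hessT, mixedVar_eq_two_mul_hessT, mixedVar_eq_two_mul_hessT] at h
  linarith

/-- [folklore] LEG-SOCKET FORM of `hessT_kkt_sq_jets`: with right inverses `kkt X₀ Q₀ · L = 1` (the bordered leg), `M₀ · Gm = 1` (the tower leg;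
`det M₀ ≠ 0` follows) and `S₀ · Gs = 1` (the coarse-Gram leg), and the letters of `mixedVar_kkt_sq_jets`:
`hessT L (kkt Xₛ Qₛ) (kkt Xₜ Qₜ) (kkt Xₛₜ Qₛₜ) = 2·hessT Gm Mₛ Mₜ Mₛₜ + hessT Gs Sₛ Sₜ Sₛₜ`. -/
theorem hessT_kkt_sq_jets_of_mul_eq_one (M₀ Mₛ Mₜ Mₛₜ X₀ Xₛ Xₜ Xₛₜ : Matrix (σ ⊕ κ) (σ ⊕ κ) ℝ) (Q₀ Qₛ Qₜ Qₛₜ : Matrix κ (σ ⊕ κ) ℝ)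
    (S₀ Sₛ Sₜ Sₛₜ : Matrix κ κ ℝ) {L : Matrix ((σ ⊕ κ) ⊕ κ) ((σ ⊕ κ) ⊕ κ) ℝ} {Gm : Matrix (σ ⊕ κ) (σ ⊕ κ) ℝ} {Gs : Matrix κ κ ℝ}
    (hL : kkt X₀ Q₀ * L = 1) (hGm : M₀ * Gm = 1) (hGs : S₀ * Gs = 1)
    (hX₀ : X₀ = M₀ * M₀) (hXₛ : Xₛ = Mₛ * M₀ + M₀ * Mₛ) (hXₜ : Xₜ = Mₜ * M₀ + M₀ * Mₜ)
    (hXₛₜ : Xₛₜ = Mₛₜ * M₀ + Mₛ * Mₜ + Mₜ * Mₛ + M₀ * Mₛₜ)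
    (hS₀ : S₀ = Q₀ * X₀⁻¹ * Q₀ᵀ)
    (hSₛ : Sₛ = Qₛ * X₀⁻¹ * Q₀ᵀ + Q₀ * X₀⁻¹ * Qₛᵀ - Q₀ * X₀⁻¹ * Xₛ * X₀⁻¹ * Q₀ᵀ)
    (hSₜ : Sₜ = Qₜ * X₀⁻¹ * Q₀ᵀ + Q₀ * X₀⁻¹ * Qₜᵀ - Q₀ * X₀⁻¹ * Xₜ * X₀⁻¹ * Q₀ᵀ)
    (hSₛₜ : Sₛₜ = Qₛₜ * X₀⁻¹ * Q₀ᵀ + Qₛ * X₀⁻¹ * Qₜᵀ + Qₜ * X₀⁻¹ * Qₛᵀ + Q₀ * X₀⁻¹ * Qₛₜᵀ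
        - Qₛ * X₀⁻¹ * Xₜ * X₀⁻¹ * Q₀ᵀ - Qₜ * X₀⁻¹ * Xₛ * X₀⁻¹ * Q₀ᵀ - Q₀ * X₀⁻¹ * Xₛ * X₀⁻¹ * Qₜᵀ - Q₀ * X₀⁻¹ * Xₜ * X₀⁻¹ * Qₛᵀ
        + Q₀ * X₀⁻¹ * Xₛ * X₀⁻¹ * Xₜ * X₀⁻¹ * Q₀ᵀ + Q₀ * X₀⁻¹ * Xₜ * X₀⁻¹ * Xₛ * X₀⁻¹ * Q₀ᵀ - Q₀ * X₀⁻¹ * Xₛₜ * X₀⁻¹ * Q₀ᵀ)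
    (hS : S₀.det ≠ 0) :
    hessT L (kkt Xₛ Qₛ) (kkt Xₜ Qₜ) (kkt Xₛₜ Qₛₜ) = 2 * hessT Gm Mₛ Mₜ Mₛₜ + hessT Gs Sₛ Sₜ Sₛₜ := by
  have hM : M₀.det ≠ 0 := by
    intro h0
    have h := congrArg Matrix.det hGm
    rw [Matrix.det_mul, h0, zero_mul, Matrix.det_one] at h
    exact zero_ne_one h
  have h := mixedVar_kkt_sq_jets M₀ Mₛ Mₜ Mₛₜ X₀ Xₛ Xₜ Xₛₜ Q₀ Qₛ Qₜ Qₛₜ S₀ Sₛ Sₜ Sₛₜ hX₀ hXₛ hXₜ hXₛₜ hS₀ hSₛ hSₜ hSₛₜ hM hS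
  rw [mixedVar_eq_two_mul_hessT_of_mul_eq_one hL, mixedVar_eq_two_mul_hessT_of_mul_eq_one hGm,
    mixedVar_eq_two_mul_hessT_of_mul_eq_one hGs] at h
  linarith

end SplitMixed

end Summit.QuantumFields.BalabanUV.Beta.D1BFx.GhostSplitJets

end
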